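import Mathlib
import HarnessLib
import Summits.Ventures.LatticeQCDFlow.Exactness.CabibboMarinariOverrelax
import Summits.Ventures.LatticeQCDFlow.Exactness.CabibboMarinariLatticeErgodic
import Summits.Ventures.LatticeQCDFlow.Exactness.CPNOverrelaxation
import Summits.Ventures.LatticeQCDFlow.Exactness.WilsonHeatBathErgodic
import Summits.Ventures.LatticeQCDFlow.Scoring.WilsonStapleSum

/-!
# The Cabibbo–Marinari over-relaxation SWEEP of `SU(N)` lattice gauge fields is exact, and the engine's `'hb' + n_or × 'or'` composite converges to the Wilson measure from every start

HONEST FRAMING: exact (Metropolis-corrected) sampling algorithms for lattice gauge theory;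
figures of merit are autocorrelation/cost numbers at stated couplings and volumes; no
continuum-physics claim.

Venture `LatticeQCDFlow` (cell pub-lqcd), topic `Exactness`, FANOUT row 9 (eng-latcore, the
engine `latflow.core.updates.composite_sweep(f, β, 'hb', n_or)` = one Cabibbo–Marinari heat-bath
sweep then `n_or` over-relaxation sweeps — the production update for `SU(3)`; `csrc/latcore_template.c`
`update_link(mode OR)`: for each subgroup frame read the staple sum `R`, project the block of `U R`
to `k ŝ`, and if `k > 0` left-multiply the link by the embedded `(ŝ†)²`).  NEW WORK of the cell
over the tree (`CabibboMarinariOverrelax.lean`: the one-link OR hit `cmOR e R` is measurable,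
Haar-preserving, involutive and conserves `Re tr (g R)`; `CPNOverrelaxation.siteUpdateMap_invariant`:
a deterministic single-coordinate map preserving its fibre law and the density along the fibre is
exact; `Scoring.WilsonStapleSum`: `S_W(h ·_e U) − S_W(U) = Re tr (ρ(U_e)R_e) − Re tr (ρ(hU_e)R_e)`
with `R_e` independent of `U_e` (`L ≥ 2`); `CabibboMarinariLatticeErgodic.latSweep_comp_uniformlyErgodic`:
the CM heat-bath sweep followed by ANY exact Markov kernel converges from every start).  Nothing is
cited as a fact.  Printed counterparts, named only: Creutz 1987, Brown–Woch 1987, Cabibbo–Marinari 1982.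

The tree had the one-link OR hit exact (gen-8) and "HB sweep followed by any exact kernel" (gen-10)
but NOT the lattice OR sweep as that kernel (TYPED-EXACTNESS-MAP, gen-16 close: "Metropolis/HB ∘ OR
on gauge groups: the instance not written").  Here (`G = SU(N)` in the defining representation
`suRep N`, torus `(ℤ/L)^d`, `L ≥ 2`):

* §1 `measurable_cmOR_uncurry` — `(ω, g) ↦ cmOR e (R(ω)) g` is jointly measurable for a continuous
  staple field `R` (identity on the closed null set `k = 0`, continuous off it);
* §2 `latStaple U e = R_e(U)` (continuous; `latStaple_update`: independent of `U_e`);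
  **`cmLatOR l e`** — THE ENGINE'S LATTICE OR HIT at link `l` in frame `e` as a deterministic kernel
  on `SU(N)^E`; **`cmLatOR_invariant`** — it leaves `e^{−βS_W} · Haar^{⊗E}` invariant for every real
  `β` (Tonelli along the link: Haar of the link is preserved by `cmOR`, and `S_W` is conserved because
  the hit conserves `Re tr (U_l R_l)` and `R_l` does not read `U_l`);
* §3 **`cmORSweep sched`** — any schedule of (link, frame) hits (the engine: every link × every pair
  `i < j`, `n_or` times) is an exact Markov kernel (`cmORSweep_invariant`);
* §4 **`wilson_cmHeatBath_orSweep_uniformlyErgodic`** — THE ENGINE'S COMPOSITE: a CM heat-bath sweep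
  (all pairs lexicographically or reversed, every link) followed by any OR schedule satisfies
  `|μ₀Kᵗ(A) − μ_{Λ,β}(A)| ≤ (1 − ε)ᵗ` for some `ε > 0`, EVERY initial law, every `t`, every set;
  **`wilsonMeasure_unique_invariant_cmHeatBath_orSweep`** — the Wilson measure is its unique
  invariant probability law.

NOT CLAIMED: OR alone (exact, never ergodic — `OverrelaxationNotErgodic.lean`); the `'metro' + 'or'`
composite (the same `minorised_comp_left` over gen-15's `wilson_sunMetropolisSweep_uniformlyErgodic`,
not restated here); other representations than the defining one for the OR move; `L = 1`; any rate;
floating point (the engine skips the hit when `k ≤ 10⁻¹²`, here when `k = 0`).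
-/

noncomputable section

namespace Summit.Ventures.LatticeQCDFlow.Exactness

open MeasureTheory ProbabilityTheory Matrix Function
open Literature.MathematicalPhysics.QuantumFieldTheory
open Summit.Ventures.LatticeQCDFlow.Scoring (stapleSum_mulSingle_self wilsonAction_mulSingle_sub)
open scoped ENNReal

/-! ## §1 Joint measurability of the OR hit in (staple, link) -/

section Joint

variable {n m : Type*} [Fintype n] [DecidableEq n] [Fintype m] [DecidableEq m] (e : n ≃ Fin 2 ⊕ m)
  {Ω : Type*} [TopologicalSpace Ω] [MeasurableSpace Ω] [BorelSpace Ω]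

omit [Fintype m] [DecidableEq m] [MeasurableSpace Ω] [BorelSpace Ω] in
/-- The quaternionic block `Q(R(ω), g)` is jointly continuous for a continuous staple field. -/
theorem continuous_cmQuat_uncurry {Rf : Ω → Matrix n n ℂ} (hR : Continuous Rf) :
    Continuous fun z : Ω × Matrix.specialUnitaryGroup n ℂ => cmQuat e (Rf z.1) z.2 := by
  unfold cmQuat
  refine continuous_quatDouble.comp ?_
  exact Continuous.matrix_submatrix (((continuous_subtype_val.comp continuous_snd).matrix_mul
    (hR.comp continuous_fst)).matrix_submatrix _ _) _ _

omit [Fintype m] [DecidableEq m] [MeasurableSpace Ω] [BorelSpace Ω] in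
/-- Off the null set the unit `ŝ(R(ω), g)` is jointly continuous. -/
theorem continuousOn_cmUnit_uncurry {Rf : Ω → Matrix n n ℂ} (hR : Continuous Rf) :
    ContinuousOn (fun z : Ω × Matrix.specialUnitaryGroup n ℂ => cmUnit e (Rf z.1) z.2)
      {z | IsQuat.normSq (cmQuat e (Rf z.1) z.2) ≠ 0} := by
  rw [Topology.IsInducing.subtypeVal.continuousOn_iff]
  have hQ := continuous_cmQuat_uncurry e hR
  have hk : Continuous fun z : Ω × Matrix.specialUnitaryGroup n ℂ =>
      ((Real.sqrt (IsQuat.normSq (cmQuat e (Rf z.1) z.2)) : ℝ) : ℂ) :=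
    Complex.continuous_ofReal.comp ((continuous_normSq.comp hQ).sqrt)
  have hcont : ContinuousOn (fun z : Ω × Matrix.specialUnitaryGroup n ℂ =>
      (((Real.sqrt (IsQuat.normSq (cmQuat e (Rf z.1) z.2))) : ℝ) : ℂ)⁻¹ • cmQuat e (Rf z.1) z.2)
      {z | IsQuat.normSq (cmQuat e (Rf z.1) z.2) ≠ 0} :=
    (hk.continuousOn.inv₀ fun z hz => Complex.ofReal_ne_zero.mpr
      (Real.sqrt_pos.mpr (lt_of_le_of_ne (IsQuat.normSq_nonneg _) (Ne.symm hz))).ne').smul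
      hQ.continuousOn
  refine hcont.congr fun z hz => ?_
  change quatUnit (cmQuat e (Rf z.1) z.2) = _
  rw [quatUnit, if_neg hz, Complex.ofReal_inv]

/-- **The OR hit is jointly measurable in (configuration, link)** for a continuous staple field:
the identity on the closed null set, continuous off it. -/
theorem measurable_cmOR_uncurry {Rf : Ω → Matrix n n ℂ} (hR : Continuous Rf) :
    Measurable fun z : Ω × Matrix.specialUnitaryGroup n ℂ => cmOR e (Rf z.1) z.2 := by
  classical
  set S := {z : Ω × Matrix.specialUnitaryGroup n ℂ | IsQuat.normSq (cmQuat e (Rf z.1) z.2) = 0} with hS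
  have hSm : MeasurableSet S :=
    (isClosed_eq (continuous_normSq.comp (continuous_cmQuat_uncurry e hR)) continuous_const).measurableSet
  have hid : ∀ z ∈ S, cmOR e (Rf z.1) z.2 = z.2 := fun z hz => by
    have := cmOR_blockEmb_mul_of_eq_zero e (Rf z.1) hz 1
    rwa [map_one, one_mul] at this
  have hpw : (fun z : Ω × Matrix.specialUnitaryGroup n ℂ => cmOR e (Rf z.1) z.2) =
      S.piecewise Prod.snd fun z => cmOR e (Rf z.1) z.2 := by
    funext z
    by_cases hz : z ∈ S
    · rw [Set.piecewise_eq_of_mem _ _ _ hz, hid z hz]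
    · rw [Set.piecewise_eq_of_notMem _ _ _ hz]
  have hon : ContinuousOn (fun z : Ω × Matrix.specialUnitaryGroup n ℂ => cmOR e (Rf z.1) z.2) Sᶜ := by
    have hu := continuousOn_cmUnit_uncurry e hR
    have h : ContinuousOn (fun z : Ω × Matrix.specialUnitaryGroup n ℂ =>
        blockEmbSU e ((cmUnit e (Rf z.1) z.2)⁻¹ * (cmUnit e (Rf z.1) z.2)⁻¹) * z.2) Sᶜ :=
      ((continuous_blockEmbSU e).comp_continuousOn ((hu.inv).mul hu.inv)).mul continuousOn_snd
    exact h
  rw [hpw]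
  exact continuousOn_snd.measurable_piecewise hon hSm

end Joint

/-! ## §2 The lattice OR hit at one link is exact for the Wilson weight -/

section Lattice

variable {d L N : ℕ} {m : Type*} [Fintype m] [DecidableEq m]

/-- The defining representation of `SU(N)` (the engine's links ARE the matrices). -/
def suRep (N : ℕ) : Matrix.specialUnitaryGroup (Fin N) ℂ →* Matrix (Fin N) (Fin N) ℂ :=
  (Matrix.specialUnitaryGroup (Fin N) ℂ).subtype

/-- `suRep N g = g` as a matrix. -/
@[simp] theorem suRep_apply (g : Matrix.specialUnitaryGroup (Fin N) ℂ) :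
    suRep N g = (g : Matrix (Fin N) (Fin N) ℂ) := rfl

/-- The defining representation is continuous. -/
theorem continuous_suRep : Continuous (suRep N) := continuous_subtype_val

/-- **The staple sum of a link**, `R_l(U) = Σ_{ν ≠ μ} (A_ν + B_ν)` (`Scoring.stapleSum` in the defining
representation), as a function of the configuration. -/
def latStaple (U : GaugeConfig d L (Matrix.specialUnitaryGroup (Fin N) ℂ)) (l : Edge d L) :
    Matrix (Fin N) (Fin N) ℂ :=
  Scoring.stapleSum (suRep N) U l.1 l.2

/-- One staple is continuous in the configuration (products and inverses of coordinates). -/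
theorem continuous_stapleUp (x : Site d L) (μ ν : Fin d) :
    Continuous fun U : GaugeConfig d L (Matrix.specialUnitaryGroup (Fin N) ℂ) => Scoring.stapleUp U x μ ν := by
  unfold Scoring.stapleUp
  fun_prop

/-- The lower staple is continuous in the configuration. -/
theorem continuous_stapleDown (x : Site d L) (μ ν : Fin d) :
    Continuous fun U : GaugeConfig d L (Matrix.specialUnitaryGroup (Fin N) ℂ) => Scoring.stapleDown U x μ ν := by
  unfold Scoring.stapleDown
  fun_prop

/-- The staple sum depends continuously on the configuration. -/
theorem continuous_latStaple (l : Edge d L) :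
    Continuous fun U : GaugeConfig d L (Matrix.specialUnitaryGroup (Fin N) ℂ) => latStaple U l := by
  obtain ⟨x, μ⟩ := l
  have hsum : ∀ ν : Fin d, Continuous fun U : GaugeConfig d L (Matrix.specialUnitaryGroup (Fin N) ℂ) =>
      suRep N (Scoring.stapleUp U x μ ν) + suRep N (Scoring.stapleDown U x μ ν) := fun ν =>
    (continuous_suRep.comp (continuous_stapleUp x μ ν)).add (continuous_suRep.comp (continuous_stapleDown x μ ν))
  exact continuous_finsetSum (Finset.univ.erase μ) fun ν _ => hsum ν

/-- `update U l g = (g · U_l⁻¹) ·_l U`. -/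
theorem update_eq_mulSingle_mul (U : GaugeConfig d L (Matrix.specialUnitaryGroup (Fin N) ℂ)) (l : Edge d L)
    (g : Matrix.specialUnitaryGroup (Fin N) ℂ) :
    update U l g = Pi.mulSingle l (g * (U l)⁻¹) * U := by
  funext l'
  by_cases h : l' = l
  · subst h
    rw [update_self, Pi.mul_apply, Pi.mulSingle_eq_same, inv_mul_cancel_right]
  · rw [update_of_ne h, Pi.mul_apply, Pi.mulSingle_eq_of_ne h, one_mul]

variable [NeZero L]

/-- **The staple sum does not read its own link** (`L ≥ 2`): `R_l(update U l g) = R_l(U)`. -/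
theorem latStaple_update (hL : 2 ≤ L) (U : GaugeConfig d L (Matrix.specialUnitaryGroup (Fin N) ℂ))
    (l : Edge d L) (g : Matrix.specialUnitaryGroup (Fin N) ℂ) :
    latStaple (update U l g) l = latStaple U l := by
  obtain ⟨x, μ⟩ := l
  rw [latStaple, latStaple, update_eq_mulSingle_mul]
  exact stapleSum_mulSingle_self (suRep N) hL U x μ _

/-- **The Wilson action along one link**: `S_W(update U l g') − S_W(update U l g) =
Re tr (g R_l) − Re tr (g' R_l)` (`L ≥ 2`). -/
theorem wilsonAction_update_sub (hL : 2 ≤ L) (U : GaugeConfig d L (Matrix.specialUnitaryGroup (Fin N) ℂ))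
    (l : Edge d L) (g g' : Matrix.specialUnitaryGroup (Fin N) ℂ) :
    wilsonAction (suRep N) (update U l g') - wilsonAction (suRep N) (update U l g) =
      (((g : Matrix (Fin N) (Fin N) ℂ) * latStaple U l).trace).re -
        (((g' : Matrix (Fin N) (Fin N) ℂ) * latStaple U l).trace).re := by
  obtain ⟨x, μ⟩ := l
  have hupd : update U (x, μ) g' = Pi.mulSingle (x, μ) (g' * g⁻¹) * update U (x, μ) g := by
    have h := update_eq_mulSingle_mul (update U (x, μ) g) (x, μ) g'
    rwa [update_idem, update_self] at h
  rw [hupd, wilsonAction_mulSingle_sub (suRep N) hL continuous_suRep (update U (x, μ) g) x μ (g' * g⁻¹),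
    update_self, inv_mul_cancel_right, ← latStaple_update hL U (x, μ) g]
  rfl

/-- The OR hit conserves `Re tr (g R)` (the real identity behind `linkWeight_cmOR`). -/
theorem re_trace_cmOR_mul (e : Fin N ≃ Fin 2 ⊕ m) (R : Matrix (Fin N) (Fin N) ℂ)
    (g : Matrix.specialUnitaryGroup (Fin N) ℂ) :
    (((cmOR e R g : Matrix (Fin N) (Fin N) ℂ) * R).trace).re = (((g : Matrix (Fin N) (Fin N) ℂ) * R).trace).re := by
  have h := linkWeight_cmOR e R 1 g
  unfold linkWeight at h
  have h' : Real.exp (1 * (((cmOR e R g : Matrix (Fin N) (Fin N) ℂ) * R).trace).re) =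
      Real.exp (1 * (((g : Matrix (Fin N) (Fin N) ℂ) * R).trace).re) :=
    (ENNReal.ofReal_eq_ofReal_iff (Real.exp_nonneg _) (Real.exp_nonneg _)).mp h
  have h'' := Real.exp_injective h'
  rwa [one_mul, one_mul] at h''

variable (β : ℝ)

/-- **THE ENGINE'S LATTICE OR HIT** at link `l` in the subgroup frame `e`: overwrite `U_l` by
`cmOR e (R_l(U)) U_l`, as a deterministic Markov kernel on `SU(N)^E`. -/
def cmLatOR (l : Edge d L) (e : Fin N ≃ Fin 2 ⊕ m) :
    Kernel (GaugeConfig d L (Matrix.specialUnitaryGroup (Fin N) ℂ))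
      (GaugeConfig d L (Matrix.specialUnitaryGroup (Fin N) ℂ)) :=
  Kernel.deterministic
    (siteUpdateMap (X := fun _ : Edge d L => Matrix.specialUnitaryGroup (Fin N) ℂ) l
      fun U g => cmOR e (latStaple U l) g)
    (measurable_siteUpdateMap (X := fun _ : Edge d L => Matrix.specialUnitaryGroup (Fin N) ℂ)
      (measurable_cmOR_uncurry e (Rf := fun U => latStaple U l) (continuous_latStaple l)))

/-- The lattice OR hit is a Markov kernel. -/
instance isMarkovKernel_cmLatOR (l : Edge d L) (e : Fin N ≃ Fin 2 ⊕ m) :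
    IsMarkovKernel (cmLatOR (d := d) (L := L) l e) := by
  unfold cmLatOR; infer_instance

/-- **THE LATTICE OR HIT IS EXACT** (`L ≥ 2`): it leaves `e^{−βS_W} · Haar^{⊗E}` invariant, for every
real `β`, every link and every frame. -/
theorem cmLatOR_invariant (hL : 2 ≤ L) (l : Edge d L) (e : Fin N ≃ Fin 2 ⊕ m) :
    Kernel.Invariant (cmLatOR (d := d) (L := L) l e)
      ((Measure.pi (linkHaar (Edge d L) (Fin N))).withDensity
        (gibbsDensity fun U : GaugeConfig d L (Matrix.specialUnitaryGroup (Fin N) ℂ) =>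
          β * wilsonAction (suRep N) U)) := by
  refine siteUpdateMap_invariant (X := fun _ : Edge d L => Matrix.specialUnitaryGroup (Fin N) ℂ)
    (μ := linkHaar (Edge d L) (Fin N))
    (measurable_cmOR_uncurry e (Rf := fun U => latStaple U l) (continuous_latStaple l))
    (fun U ξ => ?_) (fun U => ?_)
    (measurable_gibbsDensity (continuous_smul_wilsonAction (suRep N) continuous_suRep β)) (fun U ξ => ?_)
  · funext g
    rw [latStaple_update hL]
  · exact (measurePreserving_cmOR e (latStaple U l)).map_eq
  · have h := wilsonAction_update_sub hL U l ξ (cmOR e (latStaple U l) ξ)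
    rw [re_trace_cmOR_mul, sub_self] at h
    have hS : wilsonAction (suRep N) (update U l (cmOR e (latStaple U l) ξ)) =
        wilsonAction (suRep N) (update U l ξ) := by linarith
    show gibbsDensity _ (update U l (cmOR e (latStaple U l) ξ)) = gibbsDensity _ (update U l ξ)
    simp only [gibbsDensity, hS]

/-! ## §3 OR sweeps: any schedule of (link, frame) hits is exact -/

/-- **An over-relaxation sweep**: the cycle of lattice OR hits along any schedule of (link, frame)
pairs (the engine: `n_or` passes over all links × all subgroup pairs). -/
def cmORSweep (sched : List (Edge d L × (Fin N ≃ Fin 2 ⊕ m))) :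
    Kernel (GaugeConfig d L (Matrix.specialUnitaryGroup (Fin N) ℂ))
      (GaugeConfig d L (Matrix.specialUnitaryGroup (Fin N) ℂ)) :=
  cycle (sched.map fun p => cmLatOR p.1 p.2)

/-- An OR sweep is a Markov kernel. -/
instance isMarkovKernel_cmORSweep (sched : List (Edge d L × (Fin N ≃ Fin 2 ⊕ m))) :
    IsMarkovKernel (cmORSweep (d := d) (L := L) sched) := by
  unfold cmORSweep
  refine isMarkovKernel_cycle fun κ hκ => ?_
  obtain ⟨p, -, rfl⟩ := List.mem_map.1 hκ
  infer_instance

/-- **Every OR sweep is exact** for `e^{−βS_W} · Haar^{⊗E}` (`L ≥ 2`). -/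
theorem cmORSweep_invariant (hL : 2 ≤ L) (sched : List (Edge d L × (Fin N ≃ Fin 2 ⊕ m))) :
    Kernel.Invariant (cmORSweep (d := d) (L := L) sched)
      ((Measure.pi (linkHaar (Edge d L) (Fin N))).withDensity
        (gibbsDensity fun U : GaugeConfig d L (Matrix.specialUnitaryGroup (Fin N) ℂ) =>
          β * wilsonAction (suRep N) U)) := by
  unfold cmORSweep
  refine invariant_cycle fun κ hκ => ?_
  obtain ⟨p, -, rfl⟩ := List.mem_map.1 hκ
  exact cmLatOR_invariant β hL p.1 p.2

/-! ## §4 The engine's composite: heat-bath sweep, then OR sweeps — convergence from every start -/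

variable [NeZero N]

/-- **THE ENGINE'S `'hb' + n_or × 'or'` COMPOSITE CONVERGES TO THE WILSON MEASURE FROM EVERY START.**
Torus `(ℤ/L)^d` with `L ≥ 2`, gauge group `SU(N)` in the defining representation, any real `β`:
one Cabibbo–Marinari heat-bath sweep (all subgroup pairs lexicographically or reversed, every link
visited) followed by ANY over-relaxation schedule satisfies, for some `ε > 0`,
`|μ₀Kᵗ(A) − μ_{Λ,β}(A)| ≤ (1 − ε)ᵗ` for every initial law `μ₀`, every `t`, every set `A`. -/
theorem wilson_cmHeatBath_orSweep_uniformlyErgodic (hL : 2 ≤ L) (frames : List (Fin N ≃ Fin 2 ⊕ m))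
    (hlex : frames.map pairOf = lexPairs (Finset.univ.sort (· ≤ ·) : List (Fin N)) ∨
      frames.map pairOf = (lexPairs (Finset.univ.sort (· ≤ ·) : List (Fin N))).reverse)
    {links : List (Edge d L)} (hl : ∀ l, l ∈ links) (sched : List (Edge d L × (Fin N ≃ Fin 2 ⊕ m))) :
    ∃ ε : ℝ, 0 < ε ∧ ∀ (μ₀ : Measure (GaugeConfig d L (Matrix.specialUnitaryGroup (Fin N) ℂ)))
      [IsProbabilityMeasure μ₀] (t : ℕ) (A : Set (GaugeConfig d L (Matrix.specialUnitaryGroup (Fin N) ℂ))),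
      |((fun ν : Measure (GaugeConfig d L (Matrix.specialUnitaryGroup (Fin N) ℂ)) =>
          ν.bind (cmORSweep sched ∘ₖ latSweep (gibbsDensity fun U => β * wilsonAction (suRep N) U)
            frames links))^[t] μ₀).real A
        - (wilsonMeasure (suRep N) β).real A| ≤ (1 - ε) ^ t := by
  have hS : Continuous fun U : GaugeConfig d L (Matrix.specialUnitaryGroup (Fin N) ℂ) =>
      β * wilsonAction (suRep N) U := continuous_smul_wilsonAction (suRep N) continuous_suRep β
  obtain ⟨ωa, -, hmin⟩ := isCompact_univ.exists_isMinOn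
    (Set.univ_nonempty (α := GaugeConfig d L (Matrix.specialUnitaryGroup (Fin N) ℂ))) hS.continuousOn
  obtain ⟨ωb, -, hmax⟩ := isCompact_univ.exists_isMaxOn
    (Set.univ_nonempty (α := GaugeConfig d L (Matrix.specialUnitaryGroup (Fin N) ℂ))) hS.continuousOn
  have hωa : ∀ ω, β * wilsonAction (suRep N) ωa ≤ β * wilsonAction (suRep N) ω := fun ω =>
    (isMinOn_iff.1 hmin) ω (Set.mem_univ ω)
  have hωb : ∀ ω, β * wilsonAction (suRep N) ω ≤ β * wilsonAction (suRep N) ωb := fun ω =>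
    (isMaxOn_iff.1 hmax) ω (Set.mem_univ ω)
  rw [wilsonMeasure_eq_piGibbsLaw]
  exact latSweep_comp_uniformlyErgodic (measurable_gibbsDensity hS)
    (by rw [Ne, ENNReal.ofReal_eq_zero, not_le]; exact Real.exp_pos _) ENNReal.ofReal_ne_top
    (fun ω => (gibbsDensity_bounds hωa hωb ω).1) (fun ω => (gibbsDensity_bounds hωa hωb ω).2)
    frames hlex hl (cmORSweep sched) (cmORSweep_invariant β hL sched)

/-- **The Wilson measure is the unique invariant probability law of the `'hb' + 'or'` composite.** -/
theorem wilsonMeasure_unique_invariant_cmHeatBath_orSweep (hL : 2 ≤ L) (frames : List (Fin N ≃ Fin 2 ⊕ m))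
    (hlex : frames.map pairOf = lexPairs (Finset.univ.sort (· ≤ ·) : List (Fin N)) ∨
      frames.map pairOf = (lexPairs (Finset.univ.sort (· ≤ ·) : List (Fin N))).reverse)
    {links : List (Edge d L)} (hl : ∀ l, l ∈ links) (sched : List (Edge d L × (Fin N ≃ Fin 2 ⊕ m)))
    {π' : Measure (GaugeConfig d L (Matrix.specialUnitaryGroup (Fin N) ℂ))} [IsProbabilityMeasure π']
    (hπ' : Kernel.Invariant (cmORSweep sched ∘ₖ latSweep (gibbsDensity fun U => β * wilsonAction (suRep N) U)
      frames links) π') :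
    π' = wilsonMeasure (suRep N) β := by
  have hS : Continuous fun U : GaugeConfig d L (Matrix.specialUnitaryGroup (Fin N) ℂ) =>
      β * wilsonAction (suRep N) U := continuous_smul_wilsonAction (suRep N) continuous_suRep β
  obtain ⟨ωa, -, hmin⟩ := isCompact_univ.exists_isMinOn
    (Set.univ_nonempty (α := GaugeConfig d L (Matrix.specialUnitaryGroup (Fin N) ℂ))) hS.continuousOn
  obtain ⟨ωb, -, hmax⟩ := isCompact_univ.exists_isMaxOn
    (Set.univ_nonempty (α := GaugeConfig d L (Matrix.specialUnitaryGroup (Fin N) ℂ))) hS.continuousOn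
  have hωa : ∀ ω, β * wilsonAction (suRep N) ωa ≤ β * wilsonAction (suRep N) ω := fun ω =>
    (isMinOn_iff.1 hmin) ω (Set.mem_univ ω)
  have hωb : ∀ ω, β * wilsonAction (suRep N) ω ≤ β * wilsonAction (suRep N) ωb := fun ω =>
    (isMaxOn_iff.1 hmax) ω (Set.mem_univ ω)
  have hp : Measurable (gibbsDensity fun U : GaugeConfig d L (Matrix.specialUnitaryGroup (Fin N) ℂ) =>
      β * wilsonAction (suRep N) U) := measurable_gibbsDensity hS
  have hm0 : ENNReal.ofReal (Real.exp (-(β * wilsonAction (suRep N) ωb))) ≠ 0 := by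
    rw [Ne, ENNReal.ofReal_eq_zero, not_le]; exact Real.exp_pos _
  have hmp := fun ω => (gibbsDensity_bounds hωa hωb ω).1
  have hpM := fun ω => (gibbsDensity_bounds hωa hωb ω).2
  obtain ⟨ε, hε, hmin'⟩ := latSweep_minorised hp hm0 ENNReal.ofReal_ne_top hmp hpM frames hlex hl
  haveI := isMarkovKernel_latSweep hp hm0 ENNReal.ofReal_ne_top hmp hpM frames links
  haveI := isProbabilityMeasure_piGibbsLaw (μ := linkHaar (Edge d L) (Fin N)) hm0 ENNReal.ofReal_ne_top hmp hpM
  haveI : IsProbabilityMeasure ((Measure.pi (linkHaar (Edge d L) (Fin N))).bind (cmORSweep (d := d) (L := L) sched)) :=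
    ⟨by rw [Measure.bind_apply MeasurableSet.univ (Kernel.aemeasurable _)]; simp⟩
  have hmin'' := fun a => minorised_comp_left hmin' (cmORSweep sched) a
  have hinv : Kernel.Invariant (cmORSweep sched ∘ₖ latSweep (gibbsDensity fun U => β * wilsonAction (suRep N) U)
      frames links) (piGibbsLaw (linkHaar (Edge d L) (Fin N))
        (gibbsDensity fun U => β * wilsonAction (suRep N) U)) :=
    (invariant_smul (cmORSweep_invariant β hL sched) _).comp
      (latSweep_invariant_piGibbsLaw hp hm0 ENNReal.ofReal_ne_top hmp hpM frames links)
  rw [wilsonMeasure_eq_piGibbsLaw]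
  exact invariant_unique_of_minorised hmin'' (pos_iff_ne_zero.2 hε) hinv hπ'

end Lattice

end Summit.Ventures.LatticeQCDFlow.Exactness
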